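import Literature.Probability.LatticeModels.CircleWeightGaugeIdentity
import HarnessLib

/-!
# The Nishimori path identity and Garban–Spencer's estimator for a general single-bond weight

C. Garban, T. Spencer, J. Math. Phys. **63** (2022) 093302 = arXiv:2109.01617, §2, Step 1 of the
proof of Theorem 1.3 ((2.7)–(2.10)), Lemma 2.5 and Remark 1, for the plane rotator with an arbitrary
continuous positive single-bond weight `W` (`CircleWeightBondModel.lean`; Remark 10 of the source) —
the tree's `NishimoriPathIdentity.lean` / `NishimoriPathEstimator.lean` (cosine weight, `λ = I₁/I₀`)
with the von Mises moments replaced by the trigonometric moments `μ_n = ∫ (W/Z_W) zⁿ dz`. Used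
properties of `W`: continuity, positivity, `∫ Im z W(z) dz = 0` (so `μ_{±1} = λ_W`) and `λ_W > 0`
(`|μ_n| ≤ 1` is automatic). Results (theorems only): `pairAvg_holonomy` (`𝔼_W[U_T] = λ_W^{|T|₁}`),
`pairAvg_pairCexpect_diff_mul_holonomy` (**(2.8)**), `norm_pairAvg_holonomy_mul_conj_le` (the pair
bound of Lemma 2.5), `pairAvg_norm_sq_pairEstimator_le`, `one_sub_pairAvg_pairExpect_cosDiff_le`, and
`one_sub_pairExpect_one_cosDiff_le_of_mmp` — the bound
`⟨cos(θ(x) − θ(y))⟩_{W,1} ≥ 1 − (∑_{s,s'} w_s w_{s'} λ_W^{-2 overlap} − 1)^{1/2}` for the PURE model given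
the Messager–Miracle-Solé–Pfister inequality for `W` as a hypothesis (proved for the Villain weight in
`VillainMMPInequality.lean`).

## References

* C. Garban, T. Spencer, J. Math. Phys. 63 (2022) 093302, arXiv:2109.01617, §2: (2.5), (2.7)–(2.10),
  Lemma 2.5, Remark 1, Remark 10. [GarbanSpencer2022]
-/

noncomputable section

open MeasureTheory Finset TopologicalSpace
open scoped BigOperators ComplexConjugate

namespace Literature.Probability.LatticeModels

section Moments

variable [MeasurableSpace Circle] [BorelSpace Circle] {W : Circle → ℝ}

/-- `μ₀ = 1`: the law `W(z)dz/Z_W` is a probability. [folklore] -/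
theorem circleMoment_zero (hW : Continuous W) (hW0 : ∀ z, 0 < W z) :
    ∫ z, ((W z / circleWeightZ W : ℝ) : ℂ) * (z : ℂ) ^ (0 : ℤ) ∂Measure.haarMeasure (⊤ : PositiveCompacts Circle) = 1 := by
  simp only [zpow_zero, mul_one, integral_complex_ofReal, integral_div]
  rw [← circleWeightZ, div_self (circleWeightZ_pos hW hW0).ne', Complex.ofReal_one]

/-- `μ₁ = λ_W` when `∫ Im z W = 0` (the first moment is the mean resultant).
[cite: GarbanSpencer2022, (2.5)] -/
theorem circleMoment_one (hW : Continuous W)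
    (hodd : ∫ z, (z : ℂ).im * W z ∂Measure.haarMeasure (⊤ : PositiveCompacts Circle) = 0) :
    ∫ z, ((W z / circleWeightZ W : ℝ) : ℂ) * (z : ℂ) ^ (1 : ℤ) ∂Measure.haarMeasure (⊤ : PositiveCompacts Circle) =
      (circleWeightMean W : ℂ) := by
  have hint : Integrable (fun z : Circle => (z : ℂ) * (W z : ℂ))
      (Measure.haarMeasure (⊤ : PositiveCompacts Circle)) :=
    integrable_of_continuous_of_isFiniteMeasure (X := Circle) _ (by fun_prop)
  have hre := integral_re hint
  have him := integral_im hint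
  simp only [RCLike.re_to_complex, RCLike.im_to_complex, Complex.mul_re, Complex.mul_im,
    Complex.ofReal_re, Complex.ofReal_im, mul_zero, sub_zero, zero_add] at hre him
  have e : ∀ z : Circle, ((W z / circleWeightZ W : ℝ) : ℂ) * (z : ℂ) ^ (1 : ℤ) =
      ((z : ℂ) * (W z : ℂ)) * ((circleWeightZ W : ℂ))⁻¹ := fun z => by
    rw [zpow_one]; push_cast; ring
  simp_rw [e, integral_mul_const]
  rw [circleWeightMean, Complex.ofReal_div, div_eq_mul_inv]
  congr 1
  refine Complex.ext ?_ ?_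
  · rw [hre, Complex.ofReal_re]
  · rw [Complex.ofReal_im, ← him]
    exact hodd

/-- `μ₋₁ = λ_W` when `∫ Im z W = 0` (`z⁻¹ = z̄` on `U(1)`, and `W` is real). [cite: GarbanSpencer2022, (2.5)] -/
theorem circleMoment_neg_one (hW : Continuous W)
    (hodd : ∫ z, (z : ℂ).im * W z ∂Measure.haarMeasure (⊤ : PositiveCompacts Circle) = 0) :
    ∫ z, ((W z / circleWeightZ W : ℝ) : ℂ) * (z : ℂ) ^ (-1 : ℤ) ∂Measure.haarMeasure (⊤ : PositiveCompacts Circle) =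
      (circleWeightMean W : ℂ) := by
  have h1 := circleMoment_one hW hodd
  have e : ∀ z : Circle, ((W z / circleWeightZ W : ℝ) : ℂ) * (z : ℂ) ^ (-1 : ℤ) =
      conj (((W z / circleWeightZ W : ℝ) : ℂ) * (z : ℂ) ^ (1 : ℤ)) := fun z => by
    rw [map_mul, Complex.conj_ofReal, zpow_neg, zpow_one, ← Circle.coe_inv_eq_conj, Circle.coe_inv]
  simp_rw [e]
  rw [integral_conj, h1, Complex.conj_ofReal]

/-- `|μ_n| ≤ 1` for every `n` (`|zⁿ| = 1` against the probability `W dz/Z_W`). [folklore] -/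
theorem norm_circleMoment_le_one (hW : Continuous W) (hW0 : ∀ z, 0 < W z) (n : ℤ) :
    ‖∫ z, ((W z / circleWeightZ W : ℝ) : ℂ) * (z : ℂ) ^ n ∂Measure.haarMeasure (⊤ : PositiveCompacts Circle)‖ ≤ 1 := by
  have hZ := circleWeightZ_pos hW hW0
  calc ‖∫ z, ((W z / circleWeightZ W : ℝ) : ℂ) * (z : ℂ) ^ n ∂Measure.haarMeasure (⊤ : PositiveCompacts Circle)‖
      ≤ ∫ z, ‖((W z / circleWeightZ W : ℝ) : ℂ) * (z : ℂ) ^ n‖ ∂Measure.haarMeasure (⊤ : PositiveCompacts Circle) :=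
        norm_integral_le_integral_norm _
    _ = ∫ z, W z / circleWeightZ W ∂Measure.haarMeasure (⊤ : PositiveCompacts Circle) := by
        refine integral_congr_ae (ae_of_all _ fun z => ?_)
        dsimp only
        rw [norm_mul, norm_zpow, Circle.norm_coe, one_zpow, mul_one, Complex.norm_real,
          Real.norm_of_nonneg (div_nonneg (hW0 z).le hZ.le)]
    _ = 1 := by rw [integral_div, ← circleWeightZ, div_self hZ.ne']

/-- A unit moment is a power of `λ_W`: `μ_k = λ_W^{|k|}` for `|k| ≤ 1`. [cite: GarbanSpencer2022, (2.5)] -/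
theorem circleMoment_eq_pow (hW : Continuous W) (hW0 : ∀ z, 0 < W z)
    (hodd : ∫ z, (z : ℂ).im * W z ∂Measure.haarMeasure (⊤ : PositiveCompacts Circle) = 0)
    {k : ℤ} (hk : k.natAbs ≤ 1) :
    ∫ z, ((W z / circleWeightZ W : ℝ) : ℂ) * (z : ℂ) ^ k ∂Measure.haarMeasure (⊤ : PositiveCompacts Circle) =
      ((circleWeightMean W ^ k.natAbs : ℝ) : ℂ) := by
  rcases Nat.le_one_iff_eq_zero_or_eq_one.1 hk with h | h
  · rw [Int.natAbs_eq_zero.1 h, circleMoment_zero hW hW0, Int.natAbs_zero, pow_zero, Complex.ofReal_one]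
  · rw [h, pow_one]
    rcases Int.natAbs_eq k with hk' | hk' <;> rw [hk', h]
    · exact circleMoment_one hW hodd
    · exact circleMoment_neg_one hW hodd

end Moments

namespace BondSystem

variable {V ι : Type*} (G : BondSystem V ι) [Fintype ι] {W : Circle → ℝ}
section Disorder

variable [MeasurableSpace Circle] [BorelSpace Circle] {x y : V}

/-- **Independence of the phases along a chain**: `𝔼_W[U_T] = ∏_a μ_{T_a}`.
[cite: GarbanSpencer2022, §2 Step 1 and Remark 10] -/
theorem pairAvg_holonomy_eq_prod (W : Circle → ℝ) (T : G.UnitChain x y) :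
    pairAvg W T.holonomy = ∏ a, ∫ z, ((W z / circleWeightZ W : ℝ) : ℂ) * (z : ℂ) ^ T.coeff a
      ∂Measure.haarMeasure (⊤ : PositiveCompacts Circle) := by
  unfold UnitChain.holonomy
  exact pairAvg_prod W (fun a z => (z : ℂ) ^ T.coeff a)

/-- `𝔼_W[U_T] = λ_W^{|T|₁}`. [cite: GarbanSpencer2022, §2 Step 1 and Remark 10] -/
theorem pairAvg_holonomy (hW : Continuous W) (hW0 : ∀ z, 0 < W z)
    (hodd : ∫ z, (z : ℂ).im * W z ∂Measure.haarMeasure (⊤ : PositiveCompacts Circle) = 0)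
    (T : G.UnitChain x y) :
    pairAvg W T.holonomy = ((circleWeightMean W ^ T.length : ℝ) : ℂ) := by
  rw [pairAvg_holonomy_eq_prod, UnitChain.length, ← Finset.prod_pow_eq_pow_sum, Complex.ofReal_prod]
  refine Finset.prod_congr rfl fun a _ => ?_
  rw [circleMoment_eq_pow hW hW0 hodd (T.natAbs_le a)]

/-- **The pair bound behind Lemma 2.5**: `|𝔼_W[U_T · \overline{U_{T'}}]| ≤ λ_W^{#(bonds used by exactly one chain)}`
(a bond used once contributes `λ_W`, a shared bond at most `1`).
[cite: GarbanSpencer2022, proof of Lemma 2.5, first display, and Remark 10] -/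
theorem norm_pairAvg_holonomy_mul_conj_le (hW : Continuous W) (hW0 : ∀ z, 0 < W z)
    (hodd : ∫ z, (z : ℂ).im * W z ∂Measure.haarMeasure (⊤ : PositiveCompacts Circle) = 0)
    (hl : 0 < circleWeightMean W) (T T' : G.UnitChain x y) :
    ‖pairAvg W (fun u => T.holonomy u * conj (T'.holonomy u))‖ ≤
      circleWeightMean W ^ T.symmDiffCard T' := by
  have e : (fun u => T.holonomy u * conj (T'.holonomy u)) =
      fun u : ι → Circle => ∏ a, ((u a : Circle) : ℂ) ^ (T.coeff a - T'.coeff a) := by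
    funext u
    simp only [UnitChain.holonomy, map_prod, map_zpow₀, ← Finset.prod_mul_distrib]
    refine Finset.prod_congr rfl fun a _ => ?_
    rw [← Circle.coe_inv_eq_conj, Circle.coe_inv, inv_zpow', ← zpow_add₀ (Circle.coe_ne_zero _),
      sub_eq_add_neg]
  rw [e, pairAvg_prod W (fun a z => (z : ℂ) ^ (T.coeff a - T'.coeff a)), norm_prod]
  unfold UnitChain.symmDiffCard
  rw [Finset.card_filter, ← Finset.prod_pow_eq_pow_sum]
  refine Finset.prod_le_prod (fun a _ => norm_nonneg _) fun a _ => ?_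
  split_ifs with h
  · rw [pow_one]
    rcases h with ⟨h1, h2⟩ | ⟨h1, h2⟩
    · rw [h2, sub_zero, circleMoment_eq_pow hW hW0 hodd (T.natAbs_le a), Complex.norm_real,
        Real.norm_of_nonneg (pow_nonneg hl.le _)]
      have : (T.coeff a).natAbs = 1 := by
        have := Int.natAbs_ne_zero.2 h1; have := T.natAbs_le a; omega
      rw [this, pow_one]
    · rw [h1, zero_sub]
      have hk : (-T'.coeff a).natAbs ≤ 1 := by rw [Int.natAbs_neg]; exact T'.natAbs_le a
      rw [circleMoment_eq_pow hW hW0 hodd hk, Complex.norm_real, Real.norm_of_nonneg (pow_nonneg hl.le _),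
        Int.natAbs_neg]
      have : (T'.coeff a).natAbs = 1 := by
        have := Int.natAbs_ne_zero.2 h2; have := T'.natAbs_le a; omega
      rw [this, pow_one]
  · rw [pow_zero]
    exact norm_circleMoment_le_one hW hW0 _

end Disorder

section Quenched

variable [Fintype V] [MeasurableSpace Circle] [BorelSpace Circle] {x y : V}

/-- **Garban–Spencer (2.8) for the weight `W`: the Nishimori path identity.**
`𝔼_W[⟨θ̄_x θ_y⟩_{W,u} · U_T(u)] = λ_W^{|T|₁}` for every unit chain `T` from `x` to `y` (telescoping
and Lemma 2.1). [cite: GarbanSpencer2022, (2.8) and Remark 10] -/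
theorem pairAvg_pairCexpect_diff_mul_holonomy (hW : Continuous W) (hW0 : ∀ z, 0 < W z)
    (hodd : ∫ z, (z : ℂ).im * W z ∂Measure.haarMeasure (⊤ : PositiveCompacts Circle) = 0)
    (T : G.UnitChain x y) :
    pairAvg W (fun u => G.pairCexpect W u (fun θ => ((diffChar x y θ : Circle) : ℂ)) * T.holonomy u) =
      ((circleWeightMean W ^ T.length : ℝ) : ℂ) := by
  have hF : Continuous fun w : ι → Circle => ∏ a, ((w a : Circle) : ℂ) ^ T.coeff a :=
    T.continuous_holonomy
  calc pairAvg W (fun u => G.pairCexpect W u (fun θ => ((diffChar x y θ : Circle) : ℂ)) * T.holonomy u)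
      = pairAvg W (fun u => G.pairCexpect W u
          (fun θ => ∏ a, ((G.bondVar u θ a : Circle) : ℂ) ^ T.coeff a)) := by
        congr 1; funext u
        rw [← pairCexpect_mul_const]
        simp only [T.diffChar_mul_holonomy]
    _ = pairAvg W (fun w : ι → Circle => ∏ a, ((w a : Circle) : ℂ) ^ T.coeff a) :=
        G.pairAvg_pairCexpect_bondVar hW hW0 hF
    _ = _ := G.pairAvg_holonomy hW hW0 hodd T

variable {S : Type*} [Fintype S]

omit [Fintype V] in
/-- **`𝔼_W[R] = 1`** for probability weights. [cite: GarbanSpencer2022, display after (2.10), and Remark 10] -/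
theorem pairAvg_pairEstimator (hW : Continuous W) (hW0 : ∀ z, 0 < W z)
    (hodd : ∫ z, (z : ℂ).im * W z ∂Measure.haarMeasure (⊤ : PositiveCompacts Circle) = 0)
    (hl : 0 < circleWeightMean W) (w : S → ℝ) (hw1 : ∑ s, w s = 1) (T : S → G.UnitChain x y) :
    pairAvg W (G.pairEstimator W w T) = 1 := by
  have hl' := hl.ne'
  unfold pairEstimator
  rw [pairAvg_finset_sum hW Finset.univ
    (Φ := fun s u => ((w s * (circleWeightMean W)⁻¹ ^ (T s).length : ℝ) : ℂ) * (T s).holonomy u)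
    fun s _ => continuous_const.mul (T s).continuous_holonomy]
  simp_rw [pairAvg_const_mul, G.pairAvg_holonomy hW hW0 hodd]
  rw [← Complex.ofReal_one, ← hw1, Complex.ofReal_sum]
  refine Finset.sum_congr rfl fun s _ => ?_
  push_cast
  rw [mul_assoc, ← mul_pow, inv_mul_cancel₀ (by exact_mod_cast hl'), one_pow, mul_one]

/-- **Garban–Spencer (2.10) for the weight `W`**: `𝔼_W[⟨θ̄_x θ_y⟩_{W,u} R(u)] = 1`.
[cite: GarbanSpencer2022, (2.10) and Remark 10] -/
theorem pairAvg_pairCexpect_mul_pairEstimator (hW : Continuous W) (hW0 : ∀ z, 0 < W z)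
    (hodd : ∫ z, (z : ℂ).im * W z ∂Measure.haarMeasure (⊤ : PositiveCompacts Circle) = 0)
    (hl : 0 < circleWeightMean W) (w : S → ℝ) (hw1 : ∑ s, w s = 1) (T : S → G.UnitChain x y) :
    pairAvg W (fun u => G.pairCexpect W u (fun θ => ((diffChar x y θ : Circle) : ℂ)) *
      G.pairEstimator W w T u) = 1 := by
  have hl' := hl.ne'
  have hc : Continuous fun u => G.pairCexpect W u (fun θ => ((diffChar x y θ : Circle) : ℂ)) :=
    G.continuous_pairCexpect hW hW0 (continuous_subtype_val.comp
      ((map_continuous (diffChar x y)).comp continuous_snd))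
  unfold pairEstimator
  simp_rw [Finset.mul_sum]
  rw [pairAvg_finset_sum hW Finset.univ
    (Φ := fun s u => G.pairCexpect W u (fun θ => ((diffChar x y θ : Circle) : ℂ)) *
      (((w s * (circleWeightMean W)⁻¹ ^ (T s).length : ℝ) : ℂ) * (T s).holonomy u))
    fun s _ => hc.mul (continuous_const.mul (T s).continuous_holonomy)]
  have e : ∀ s (u : ι → Circle), G.pairCexpect W u (fun θ => ((diffChar x y θ : Circle) : ℂ)) *
      (((w s * (circleWeightMean W)⁻¹ ^ (T s).length : ℝ) : ℂ) * (T s).holonomy u) =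
      ((w s * (circleWeightMean W)⁻¹ ^ (T s).length : ℝ) : ℂ) *
        (G.pairCexpect W u (fun θ => ((diffChar x y θ : Circle) : ℂ)) * (T s).holonomy u) := by
    intro s u; ring
  simp_rw [e, pairAvg_const_mul, G.pairAvg_pairCexpect_diff_mul_holonomy hW hW0 hodd]
  rw [← Complex.ofReal_one, ← hw1, Complex.ofReal_sum]
  refine Finset.sum_congr rfl fun s _ => ?_
  push_cast
  rw [mul_assoc, ← mul_pow, inv_mul_cancel₀ (by exact_mod_cast hl'), one_pow, mul_one]

omit [Fintype V] in
/-- **The second moment of the estimator (Lemma 2.5) for the weight `W`**: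
`𝔼_W[|R|²] ≤ ∑_{s,s'} w_s w_{s'} λ_W^{-2 overlap(T_s, T_{s'})}` for non-negative weights.
[cite: GarbanSpencer2022, proof of Lemma 2.5, first display, and Remark 10] -/
theorem pairAvg_norm_sq_pairEstimator_le (hW : Continuous W) (hW0 : ∀ z, 0 < W z)
    (hodd : ∫ z, (z : ℂ).im * W z ∂Measure.haarMeasure (⊤ : PositiveCompacts Circle) = 0)
    (hl : 0 < circleWeightMean W) (w : S → ℝ) (hw : ∀ s, 0 ≤ w s) (T : S → G.UnitChain x y) :
    pairAvg W (fun u => ‖G.pairEstimator W w T u‖ ^ 2) ≤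
      ∑ s, ∑ s', w s * w s' * ((circleWeightMean W) ^ 2)⁻¹ ^ (T s).overlap (T s') := by
  set lam := circleWeightMean W with hlam
  set c : S → ℝ := fun s => w s * lam⁻¹ ^ (T s).length with hc
  have hc0 : ∀ s, 0 ≤ c s := fun s => mul_nonneg (hw s) (pow_nonneg (inv_nonneg.2 hl.le) _)
  -- |R|² = Re (R R̄) = Re ∑∑ c c' U_s Ū_{s'}
  have hsq : ∀ u, ‖G.pairEstimator W w T u‖ ^ 2 =
      (∑ s, ∑ s', ((c s * c s' : ℝ) : ℂ) * ((T s).holonomy u * conj ((T s').holonomy u))).re := by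
    intro u
    have hn : (Complex.normSq (G.pairEstimator W w T u) : ℝ) =
        (G.pairEstimator W w T u * conj (G.pairEstimator W w T u)).re := by
      rw [Complex.mul_conj, Complex.ofReal_re]
    rw [← Complex.normSq_eq_norm_sq, hn]
    congr 1
    rw [pairEstimator, map_sum, Finset.sum_mul_sum]
    simp only [hc]
    refine Finset.sum_congr rfl fun s _ => Finset.sum_congr rfl fun s' _ => ?_
    rw [map_mul, Complex.conj_ofReal]
    push_cast
    ring
  have hcont : ∀ s s', Continuous fun u : ι → Circle =>
      ((c s * c s' : ℝ) : ℂ) * ((T s).holonomy u * conj ((T s').holonomy u)) := fun s s' =>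
    continuous_const.mul ((T s).continuous_holonomy.mul
      (Complex.continuous_conj.comp (T s').continuous_holonomy))
  simp_rw [hsq]
  rw [← re_pairAvg hW (continuous_finsetSum _ fun s _ => continuous_finsetSum _ fun s' _ => hcont s s'),
    pairAvg_finset_sum hW _ (fun s _ => continuous_finsetSum _ fun s' _ => hcont s s'),
    Complex.re_sum]
  refine Finset.sum_le_sum fun s _ => ?_
  rw [pairAvg_finset_sum hW _ (fun s' _ => hcont s s'), Complex.re_sum]
  refine Finset.sum_le_sum fun s' _ => ?_
  have hM := G.norm_pairAvg_holonomy_mul_conj_le hW hW0 hodd hl (T s) (T s')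
  rw [pairAvg_const_mul, Complex.re_ofReal_mul]
  -- c c' Re M ≤ c c' |M| ≤ c c' λ^{sd} = w w' λ^{-2 ov}
  calc c s * c s' * (pairAvg W fun u => (T s).holonomy u * conj ((T s').holonomy u)).re
      ≤ c s * c s' * lam ^ (T s).symmDiffCard (T s') :=
        mul_le_mul_of_nonneg_left ((Complex.re_le_norm _).trans hM) (mul_nonneg (hc0 s) (hc0 s'))
    _ = w s * w s' * (lam ^ 2)⁻¹ ^ (T s).overlap (T s') := by
        have hlen := (T s).length_add_length (T s')
        have key : lam⁻¹ ^ (T s).length * lam⁻¹ ^ (T s').length =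
            lam⁻¹ ^ (T s).symmDiffCard (T s') * (lam ^ 2)⁻¹ ^ (T s).overlap (T s') := by
          rw [← pow_add, hlen, pow_add, pow_mul, inv_pow lam 2]
        have k2 : lam⁻¹ ^ (T s).symmDiffCard (T s') * lam ^ (T s).symmDiffCard (T s') = 1 := by
          rw [← mul_pow, inv_mul_cancel₀ hl.ne', one_pow]
        simp only [hc]
        calc w s * lam⁻¹ ^ (T s).length * (w s' * lam⁻¹ ^ (T s').length) * lam ^ (T s).symmDiffCard (T s')
            = w s * w s' * ((lam⁻¹ ^ (T s).length * lam⁻¹ ^ (T s').length) *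
                lam ^ (T s).symmDiffCard (T s')) := by ring
          _ = w s * w s' * ((lam⁻¹ ^ (T s).symmDiffCard (T s') * lam ^ (T s).symmDiffCard (T s')) *
                (lam ^ 2)⁻¹ ^ (T s).overlap (T s')) := by rw [key]; ring
          _ = _ := by rw [k2, one_mul]

/-- **Garban–Spencer, end of Step 1, for the weight `W`**: for every path ensemble (probability
weights `w` on unit chains `T_s` from `x` to `y`),
`1 − 𝔼_W[⟨cos(θ(x) − θ(y))⟩_{W,u}] ≤ (∑_{s,s'} w_s w_{s'} λ_W^{-2 overlap(T_s,T_{s'})} − 1)^{1/2}`.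
[cite: GarbanSpencer2022, proof of Theorem 1.3, Step 1, display after Lemma 2.5, and Remark 10] -/
theorem one_sub_pairAvg_pairExpect_cosDiff_le (hW : Continuous W) (hW0 : ∀ z, 0 < W z)
    (hodd : ∫ z, (z : ℂ).im * W z ∂Measure.haarMeasure (⊤ : PositiveCompacts Circle) = 0)
    (hl : 0 < circleWeightMean W) (w : S → ℝ) (hw : ∀ s, 0 ≤ w s) (hw1 : ∑ s, w s = 1)
    (T : S → G.UnitChain x y) :
    1 - pairAvg W (fun u => G.pairExpect W u (cosDiff x y)) ≤
      Real.sqrt (∑ s, ∑ s', w s * w s' * ((circleWeightMean W) ^ 2)⁻¹ ^ (T s).overlap (T s') - 1) := by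
  set R := G.pairEstimator W w T with hR
  set C : (ι → Circle) → ℂ := fun u => G.pairCexpect W u (fun θ => ((diffChar x y θ : Circle) : ℂ)) with hC
  have hRc : Continuous R := G.continuous_pairEstimator W w T
  have hdc : Continuous (Function.uncurry fun (_ : ι → Circle) (θ : V → Circle) =>
      ((diffChar x y θ : Circle) : ℂ)) :=
    continuous_subtype_val.comp ((map_continuous (diffChar x y)).comp continuous_snd)
  have hCc : Continuous C := G.continuous_pairCexpect hW hW0 hdc
  have hC1 : ∀ u, ‖C u‖ ≤ 1 := fun u =>
    G.norm_pairCexpect_le hW hW0 u _ fun θ => (Circle.norm_coe _).le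
  -- the real two-point function is the real part of `C`
  have hre : ∀ u, G.pairExpect W u (cosDiff x y) = (C u).re := by
    intro u
    rw [hC, G.re_pairCexpect hW u (F := fun θ => ((diffChar x y θ : Circle) : ℂ))
      (continuous_subtype_val.comp (map_continuous (diffChar x y)))]
    congr 1; funext θ; exact cosDiff_eq_reChar x y θ
  -- 1 − 𝔼 Re C = Re 𝔼[C (R − 1)]
  have h1 : 1 - pairAvg W (fun u => G.pairExpect W u (cosDiff x y)) =
      (pairAvg W (fun u => C u * (R u - 1))).re := by
    simp_rw [hre, mul_sub, mul_one]
    rw [pairAvg_sub hW (Φ := fun u => C u * R u) (Ψ := C) (hCc.mul hRc) hCc, Complex.sub_re,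
      hR, hC, G.pairAvg_pairCexpect_mul_pairEstimator hW hW0 hodd hl w hw1 T, Complex.one_re, ← hC,
      ← re_pairAvg hW hCc]
  -- Re 𝔼[C(R−1)] ≤ 𝔼 |R − 1|
  have h2 : (pairAvg W (fun u => C u * (R u - 1))).re ≤ pairAvg W (fun u => ‖R u - 1‖) := by
    refine (Complex.re_le_norm _).trans ((norm_pairAvg_le hW hW0 _).trans ?_)
    refine pairAvg_mono hW hW0 (Φ := fun u => ‖C u * (R u - 1)‖) (Ψ := fun u => ‖R u - 1‖)
      ((hCc.mul (hRc.sub continuous_const)).norm) (hRc.sub continuous_const).norm fun u => ?_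
    rw [norm_mul]
    exact mul_le_of_le_one_left (norm_nonneg _) (hC1 u)
  -- 𝔼|R − 1|² ≤ 𝔼|R|² − 1 (Jensen, and 𝔼 R = 1)
  have h3 : pairAvg W (fun u => ‖R u - 1‖) ^ 2 ≤ pairAvg W (fun u => ‖R u‖ ^ 2) - 1 := by
    refine (pairAvg_sq_le hW hW0 (g := fun u => ‖R u - 1‖) (hRc.sub continuous_const).norm).trans_eq ?_
    have e : (fun u => ‖R u - 1‖ ^ 2) = fun u => (‖R u‖ ^ 2 - 2 * (R u).re) + 1 := by
      funext u
      rw [← Complex.normSq_eq_norm_sq, ← Complex.normSq_eq_norm_sq, Complex.normSq_sub]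
      simp only [map_one, mul_one]
      ring
    rw [e, pairAvg_add hW (Φ := fun u => ‖R u‖ ^ 2 - 2 * (R u).re) (Ψ := fun _ => (1 : ℝ))
        ((hRc.norm.pow 2).sub (continuous_const.mul (Complex.continuous_re.comp hRc))) continuous_const,
      pairAvg_sub hW (Φ := fun u => ‖R u‖ ^ 2) (Ψ := fun u => 2 * (R u).re) (hRc.norm.pow 2)
        (continuous_const.mul (Complex.continuous_re.comp hRc)),
      pairAvg_const_mul_real W 2 (fun u => (R u).re), ← re_pairAvg hW hRc, hR,
      G.pairAvg_pairEstimator hW hW0 hodd hl w hw1 T, pairAvg_const hW hW0]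
    norm_num; ring
  have h4 := G.pairAvg_norm_sq_pairEstimator_le hW hW0 hodd hl w hw T
  rw [← hR] at h4
  have h0 : 0 ≤ pairAvg W (fun u => ‖R u - 1‖) := by
    unfold pairAvg
    exact integral_nonneg fun u => smul_nonneg (pairDensity_pos hW hW0 u).le (norm_nonneg _)
  rw [h1]
  calc (pairAvg W (fun u => C u * (R u - 1))).re ≤ pairAvg W (fun u => ‖R u - 1‖) := h2
    _ = Real.sqrt (pairAvg W (fun u => ‖R u - 1‖) ^ 2) := (Real.sqrt_sq h0).symm
    _ ≤ Real.sqrt (pairAvg W (fun u => ‖R u‖ ^ 2) - 1) := Real.sqrt_le_sqrt h3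
    _ ≤ _ := Real.sqrt_le_sqrt (by linarith [h4])

/-- **Garban–Spencer, Theorem 1.3 ∘ Remark 1, deterministic part, for the weight `W`.** If the
Messager–Miracle-Solé–Pfister inequality holds for `W` (quenched phases lower the two-point function,
hypothesis `hmmp`; proved for the cosine weight in `MMPInequality.lean` and for the Villain weight in
`VillainMMPInequality.lean`), then for the PURE model (`u ≡ 1`), any two vertices and any path ensemble:
`⟨cos(θ(x) − θ(y))⟩_{W,1} ≥ 1 − (∑_{s,s'} w_s w_{s'} (λ_W²)^{-overlap(T_s,T_{s'})} − 1)^{1/2}`.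
[cite: GarbanSpencer2022, Theorem 1.3 with Remark 1, Lemma 2.5 and Remark 10] -/
theorem one_sub_pairExpect_one_cosDiff_le_of_mmp (hW : Continuous W) (hW0 : ∀ z, 0 < W z)
    (hodd : ∫ z, (z : ℂ).im * W z ∂Measure.haarMeasure (⊤ : PositiveCompacts Circle) = 0)
    (hl : 0 < circleWeightMean W)
    (hmmp : ∀ u : ι → Circle, G.pairExpect W u (cosDiff x y) ≤ G.pairExpect W 1 (cosDiff x y))
    (w : S → ℝ) (hw : ∀ s, 0 ≤ w s) (hw1 : ∑ s, w s = 1) (T : S → G.UnitChain x y) :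
    1 - G.pairExpect W 1 (cosDiff x y) ≤
      Real.sqrt (∑ s, ∑ s', w s * w s' * ((circleWeightMean W) ^ 2)⁻¹ ^ (T s).overlap (T s') - 1) := by
  have hle : pairAvg W (fun u => G.pairExpect W u (cosDiff x y)) ≤ G.pairExpect W 1 (cosDiff x y) := by
    refine pairAvg_le_const hW hW0 ?_ hmmp
    have hdc : Continuous (Function.uncurry fun (_ : ι → Circle) (θ : V → Circle) =>
        ((diffChar x y θ : Circle) : ℂ)) :=
      continuous_subtype_val.comp ((map_continuous (diffChar x y)).comp continuous_snd)
    have hCc := G.continuous_pairCexpect hW hW0 hdc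
    have e : (fun u => G.pairExpect W u (cosDiff x y)) =
        fun u => (G.pairCexpect W u (fun θ => ((diffChar x y θ : Circle) : ℂ))).re := by
      funext u
      rw [G.re_pairCexpect hW u (F := fun θ => ((diffChar x y θ : Circle) : ℂ))
        (continuous_subtype_val.comp (map_continuous (diffChar x y)))]
      congr 1; funext θ; exact cosDiff_eq_reChar x y θ
    rw [e]
    exact Complex.continuous_re.comp hCc
  linarith [G.one_sub_pairAvg_pairExpect_cosDiff_le hW hW0 hodd hl w hw hw1 T]

end Quenched

end BondSystem

end Literature.Probability.LatticeModels
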